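import Summits.CriticalPhenomena.PercolationContinuityZ3.Theorems.FK.RandomClusterEdgeCountChernoff
import Summits.CriticalPhenomena.PercolationContinuityZ3.Theorems.FK.PressureConvexity
import HarnessLib

/-!
# LARGE DEVIATIONS OF THE RANDOM-CLUSTER MODEL, VIII: THE TWO-PARAMETER EXPONENTIAL FAMILY IN `(π, κ) = (log(p/(1−p)), log q)` WITH
# NATURAL STATISTIC THE PAIR `(|ω|, k^B(ω))` — JOINT MOMENT GENERATING FUNCTION AND HALF-PLANE CHERNOFF BOUNDS (any finite graph, any
# wired set; Grimmett 2006 Thm. (4.58) and §4.5 (4.72), (4.80); Ellis 2006 Thm. II.6.1, §VII.3)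

Claimed R42 (8)(c) in the cell INBOX at 2026-08-29T14:40:45Z by fkp-10a gen 360 (NEW CLAIM #8 of the gen), addressed to coordinator fk-4 gen 299 (seated 12:03Z 2026-08-29; R182–R188 in force; ruling R189 requested); lineage row FO-10a-g360j (self-suggested), package g360-jointld, label JC-A.
Helper file of the `fk-continuity` build cell (bschramm lane; `--supports stmt-CriticalPhenomena-4575`; fkp-10a gen 360,
package g360-jointld, label JC-A); builds on p205010 (kernel theorem, internal audit signed; external expert review
pending). No definitions, no named facts, no sorries; standard axioms.
UNCONDITIONAL (random-cluster measure `φ^B_{G,p,q}` of ANY finite simple graph `G` with ANY wired vertex set `B`, `p, p' ∈ (0,1)`,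
`q, q' > 0`; `|ω|` = number of open edges, `k^B(ω) = clusterCount ω B`, `|E| = |E(G)|`, `L(p,q) = log Z^B_{G,p,q} − |E| log(1−p)`).
Scope: finite-volume identities and inequalities (no infinite-volume statement, no `p_c`, nothing about FH / TP_FK).

With `t = log(p'(1−p)/(p(1−p')))`, `s = log(q'/q)`:

* **`rcExpect_exp_mul_card_add_mul_clusterCount`** — THE JOINT MOMENT GENERATING FUNCTION
  `E^B_{G,p,q} e^{t|ω| + s k^B(ω)} = ((1−p)/(1−p'))^{|E|} · Z(p',q')/Z(p,q)` (`rcWeight_eq_mul_ratio₂`): the random-cluster measures are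
  a two-parameter exponential family in `(π, κ)` with natural statistic `(|ω|, k^B)` and cumulant generating function the increment of the
  jointly convex `L` (tree: `convexOn_log_rcPartitionFunction_logistic_exp`); `log_rcExpect_exp_mul_card_add_mul_clusterCount`;
* `mul_rcExpect_card_add_mul_rcExpect_clusterCount_le_sub` — the SUPPORTING-HYPERPLANE (tangent) inequality
  `t E_{p,q}|ω| + s E_{p,q} k ≤ L(p',q') − L(p,q)` (the tree's `log_rcPartitionFunction_sub_ge₂` rearranged);
* **`rcExpect_indicator_le_linear_le`** / `rcMeasure_real_le_linear_le` — HALF-PLANE CHERNOFF BOUND, every direction `(t,s)` and level `a`: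
  `φ^B_{G,p,q}{a ≤ t|ω| + s k^B} ≤ exp(−(a − (L(p',q') − L(p,q))))` — the finite-volume form of the upper large-deviation bound for the pair
  `(|ω|, k^B)` over half-planes (Ellis II.6.1 (b) in `ℝ²`).

## References

* G. Grimmett, *The Random-Cluster Model*, Springer (2006), §1.2 eq. (1.2), §4.5 Thm. (4.58), (4.72), (4.80). [Grimmett2006]
* R. S. Ellis, *Entropy, Large Deviations, and Statistical Mechanics*, Springer (2006), Thm. II.6.1, §VII.3. [Ellis2006]
-/

noncomputable section

namespace Summit.CriticalPhenomena.PercolationContinuityZ3.Theorems.FK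

namespace RandomClusterLargeDeviations

open Finset Set
open Literature.Probability.LatticeModels Literature.Probability.Percolation

variable {V : Type*} [Fintype V] [DecidableEq V] (G : SimpleGraph V) [DecidableRel G.Adj]

/-! ### The joint moment generating function of `(|ω|, k^B)` -/

/-- **THE JOINT MOMENT GENERATING FUNCTION**: for `p, p' ∈ (0,1)`, `q, q' > 0`, any wired set `B`, with `t = log(p'(1−p)/(p(1−p')))` and
`s = log(q'/q)`: `E^B_{G,p,q} e^{t|ω| + s k^B(ω)} = ((1−p)/(1−p'))^{|E|} · Z^B_{G,p',q'}/Z^B_{G,p,q}`.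
[cite: Grimmett2006, §4.5 Thm. (4.58), (4.72), (4.80); Ellis2006, §VII.3] -/
theorem rcExpect_exp_mul_card_add_mul_clusterCount {p p' q q' : ℝ} (hp : p ∈ Set.Ioo (0 : ℝ) 1) (hp' : p' ∈ Set.Ioo (0 : ℝ) 1)
    (hq : 0 < q) (hq' : 0 < q') (B : Set V) :
    rcExpect G p q B (fun ω => Real.exp (Real.log (p' * (1 - p) / (p * (1 - p'))) * #ω +
        Real.log (q' / q) * clusterCount (↑ω : BondConfig V) B)) =
      ((1 - p) / (1 - p')) ^ #G.edgeFinset * (rcPartitionFunction G p' q' B / rcPartitionFunction G p q B) := by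
  have hpI : p ∈ Set.Icc (0 : ℝ) 1 := ⟨hp.1.le, hp.2.le⟩
  have h1p : 0 < 1 - p := sub_pos.2 hp.2
  have h1p' : 0 < 1 - p' := sub_pos.2 hp'.2
  -- `Z(p',q')/Z(p,q) = E_{p,q}[(p'/p)^{|ω|}((1−p')/(1−p))^{|E∖ω|}(q'/q)^{k}]`
  have hquot : rcPartitionFunction G p' q' B / rcPartitionFunction G p q B =
      rcExpect G p q B (fun ω => (p' / p) ^ #ω * ((1 - p') / (1 - p)) ^ #(G.edgeFinset \ ω) *
        (q' / q) ^ clusterCount (↑ω : BondConfig V) B) := by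
    rw [rcExpect, rcPartitionFunction, Finset.sum_div]
    refine Finset.sum_congr rfl fun ω _ => ?_
    rw [rcWeight_eq_mul_ratio₂ G hp hq p' q' B ω, mul_div_right_comm]
  have h2 : rcExpect G p q B (fun ω => (p' / p) ^ #ω * ((1 - p') / (1 - p)) ^ #(G.edgeFinset \ ω) *
        (q' / q) ^ clusterCount (↑ω : BondConfig V) B) =
      ((1 - p') / (1 - p)) ^ #G.edgeFinset * rcExpect G p q B (fun ω =>
        Real.exp (Real.log (p' * (1 - p) / (p * (1 - p'))) * #ω + Real.log (q' / q) * clusterCount (↑ω : BondConfig V) B)) := by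
    rw [← rcExpect_const_mul]
    refine rcExpect_congr G p q B fun ω hω => ?_
    rw [ratio_pow_mul_pow_eq G hp hp' hω, Real.exp_add,
      ← Real.exp_log (pow_pos (div_pos hq' hq) (clusterCount (↑ω : BondConfig V) B)), Real.log_pow,
      mul_comm (↑(clusterCount (↑ω : BondConfig V) B) : ℝ) (Real.log (q' / q))]
    ring
  rw [hquot, h2, ← mul_assoc, ← mul_pow, div_mul_div_comm, mul_comm (1 - p) (1 - p'), div_self (by positivity), one_pow, one_mul]

/-- **THE JOINT CUMULANT GENERATING FUNCTION IS THE INCREMENT OF `L(p,q) = log Z(p,q) − |E| log(1−p)`**: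
`log E_{p,q} e^{t|ω| + s k} = L(p',q') − L(p,q)`. [cite: Grimmett2006, §4.5 Thm. (4.58), (4.72); Ellis2006, (2.28)] -/
theorem log_rcExpect_exp_mul_card_add_mul_clusterCount {p p' q q' : ℝ} (hp : p ∈ Set.Ioo (0 : ℝ) 1) (hp' : p' ∈ Set.Ioo (0 : ℝ) 1)
    (hq : 0 < q) (hq' : 0 < q') (B : Set V) :
    Real.log (rcExpect G p q B (fun ω => Real.exp (Real.log (p' * (1 - p) / (p * (1 - p'))) * #ω +
        Real.log (q' / q) * clusterCount (↑ω : BondConfig V) B))) =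
      (Real.log (rcPartitionFunction G p' q' B) - #G.edgeFinset * Real.log (1 - p')) -
        (Real.log (rcPartitionFunction G p q B) - #G.edgeFinset * Real.log (1 - p)) := by
  have h1p : 0 < 1 - p := sub_pos.2 hp.2
  have h1p' : 0 < 1 - p' := sub_pos.2 hp'.2
  have hZ := rcPartitionFunction_pos G ⟨hp.1.le, hp.2.le⟩ hq B
  have hZ' := rcPartitionFunction_pos G ⟨hp'.1.le, hp'.2.le⟩ hq' B
  rw [rcExpect_exp_mul_card_add_mul_clusterCount G hp hp' hq hq' B,
    Real.log_mul (pow_pos (div_pos h1p h1p') _).ne' (div_pos hZ' hZ).ne', Real.log_pow, Real.log_div h1p.ne' h1p'.ne',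
    Real.log_div hZ'.ne' hZ.ne']
  ring

/-! ### The supporting hyperplane and the half-plane Chernoff bound -/

/-- **SUPPORTING-HYPERPLANE INEQUALITY `t E_{p,q}|ω| + s E_{p,q} k ≤ L(p',q') − L(p,q)`** (Jensen; the tree's
`log_rcPartitionFunction_sub_ge₂` rearranged with `log((1−p')/(1−p))·|E|` moved into `L`). [cite: Grimmett2006, Thm. (4.58) (proof)] -/
theorem mul_rcExpect_card_add_mul_rcExpect_clusterCount_le_sub {p p' q q' : ℝ} (hp : p ∈ Set.Ioo (0 : ℝ) 1)
    (hp' : p' ∈ Set.Ioo (0 : ℝ) 1) (hq : 0 < q) (hq' : 0 < q') (B : Set V) :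
    Real.log (p' * (1 - p) / (p * (1 - p'))) * rcExpect G p q B (fun ω => (#ω : ℝ)) +
        Real.log (q' / q) * rcExpect G p q B (fun ω => (clusterCount (↑ω : BondConfig V) B : ℝ)) ≤
      (Real.log (rcPartitionFunction G p' q' B) - #G.edgeFinset * Real.log (1 - p')) -
        (Real.log (rcPartitionFunction G p q B) - #G.edgeFinset * Real.log (1 - p)) := by
  have h := log_rcPartitionFunction_sub_ge₂ G hp hp' hq hq' B
  have h1p : 0 < 1 - p := sub_pos.2 hp.2
  have h1p' : 0 < 1 - p' := sub_pos.2 hp'.2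
  have hlog : Real.log (p' * (1 - p) / (p * (1 - p'))) = Real.log (p' / p) - Real.log ((1 - p') / (1 - p)) := by
    rw [← Real.log_div (div_pos hp'.1 hp.1).ne' (div_pos h1p' h1p).ne']
    congr 1
    field_simp
  have hlog' : Real.log ((1 - p') / (1 - p)) = Real.log (1 - p') - Real.log (1 - p) := Real.log_div h1p'.ne' h1p.ne'
  rw [hlog]
  rw [hlog'] at h ⊢
  linarith

/-- **HALF-PLANE CHERNOFF BOUND**: for every direction `(t,s)` realised by `p' ∈ (0,1)`, `q' > 0` and every level `a`,
`φ^B_{G,p,q}{a ≤ t|ω| + s k^B(ω)} ≤ exp(−(a − (L(p',q') − L(p,q))))`. [cite: Ellis2006, Thm. II.6.1 (b) (proof); Grimmett2006, Thm. (4.58)] -/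
theorem rcExpect_indicator_le_linear_le {p p' q q' : ℝ} (hp : p ∈ Set.Ioo (0 : ℝ) 1) (hp' : p' ∈ Set.Ioo (0 : ℝ) 1) (hq : 0 < q)
    (hq' : 0 < q') (B : Set V) (a : ℝ) :
    rcExpect G p q B (fun ω => if a ≤ Real.log (p' * (1 - p) / (p * (1 - p'))) * #ω +
        Real.log (q' / q) * clusterCount (↑ω : BondConfig V) B then 1 else 0) ≤
      Real.exp (-(a - ((Real.log (rcPartitionFunction G p' q' B) - #G.edgeFinset * Real.log (1 - p')) -
        (Real.log (rcPartitionFunction G p q B) - #G.edgeFinset * Real.log (1 - p))))) := by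
  have hpI : p ∈ Set.Icc (0 : ℝ) 1 := ⟨hp.1.le, hp.2.le⟩
  set X : Finset (Sym2 V) → ℝ := fun ω => Real.log (p' * (1 - p) / (p * (1 - p'))) * #ω +
    Real.log (q' / q) * clusterCount (↑ω : BondConfig V) B with hX
  -- Markov: `1{a ≤ X} ≤ e^{X − a}`
  have hmono : rcExpect G p q B (fun ω => if a ≤ X ω then 1 else 0) ≤
      rcExpect G p q B (fun ω => Real.exp (-a) * Real.exp (X ω)) := by
    refine rcExpect_mono G hpI hq B fun ω _ => ?_
    split_ifs with h
    · rw [← Real.exp_add]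
      linarith [Real.add_one_le_exp (-a + X ω)]
    · positivity
  have hpos : 0 < rcExpect G p q B (fun ω => Real.exp (X ω)) := by
    rw [hX, rcExpect_exp_mul_card_add_mul_clusterCount G hp hp' hq hq' B]
    exact mul_pos (pow_pos (div_pos (sub_pos.2 hp.2) (sub_pos.2 hp'.2)) _)
      (div_pos (rcPartitionFunction_pos G ⟨hp'.1.le, hp'.2.le⟩ hq' B) (rcPartitionFunction_pos G hpI hq B))
  calc rcExpect G p q B (fun ω => if a ≤ X ω then 1 else 0)
      ≤ Real.exp (-a) * rcExpect G p q B (fun ω => Real.exp (X ω)) := by rwa [← rcExpect_const_mul]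
    _ = Real.exp (-(a - ((Real.log (rcPartitionFunction G p' q' B) - #G.edgeFinset * Real.log (1 - p')) -
          (Real.log (rcPartitionFunction G p q B) - #G.edgeFinset * Real.log (1 - p))))) := by
        rw [← Real.exp_log hpos, ← Real.exp_add, hX, log_rcExpect_exp_mul_card_add_mul_clusterCount G hp hp' hq hq' B]
        congr 1
        ring

/-- **HALF-PLANE CHERNOFF BOUND, measure form**: `φ^B_{G,p,q}{η | a ≤ t|η| + s k^B(η)} ≤ exp(−(a − (L(p',q') − L(p,q))))`.
[cite: Ellis2006, Thm. II.6.1 (b); Grimmett2006, Thm. (4.58)] -/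
theorem rcMeasure_real_le_linear_le {p p' q q' : ℝ} (hp : p ∈ Set.Ioo (0 : ℝ) 1) (hp' : p' ∈ Set.Ioo (0 : ℝ) 1) (hq : 0 < q)
    (hq' : 0 < q') (B : Set V) (a : ℝ) :
    (rcMeasure G p q B).real {η : BondConfig V | a ≤ Real.log (p' * (1 - p) / (p * (1 - p'))) * η.ncard +
        Real.log (q' / q) * clusterCount η B} ≤
      Real.exp (-(a - ((Real.log (rcPartitionFunction G p' q' B) - #G.edgeFinset * Real.log (1 - p')) -
        (Real.log (rcPartitionFunction G p q B) - #G.edgeFinset * Real.log (1 - p))))) := by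
  classical
  rw [rcMeasure_real_eq_rcExpect G ⟨hp.1.le, hp.2.le⟩ hq B]
  refine le_of_eq_of_le (rcExpect_congr G p q B fun ω _ => ?_) (rcExpect_indicator_le_linear_le G hp hp' hq hq' B a)
  simp only [Set.mem_setOf_eq, Set.ncard_coe_finset]

end RandomClusterLargeDeviations

end Summit.CriticalPhenomena.PercolationContinuityZ3.Theorems.FK
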